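import Literature.NumberTheory.EllipticCurves.Wuthrich2014.ReducibleDivisibility
import Literature.NumberTheory.EllipticCurves.LeadingTermPPartRankLeOne
import Literature.NumberTheory.EllipticCurves.ComplexMultiplicationBurungaleFlachProofs
import Literature.NumberTheory.EllipticCurves.MordellWeilRankZeroProofs
import Literature.NumberTheory.EllipticCurves.LeadingTerm
import HarnessLib

/-!
# Wuthrich 2014, Prop. 21: the two tree spellings are equivalent (dedup bridge)

`Proofs` companion (theorems only). Proposition 21 of C. Wuthrich, Doc. Math. 19 (2014) 381–402
was transcribed twice on 2026-08-18, three minutes apart: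

* `Literature.NumberTheory.EllipticCurves.Wuthrich2014_shaOrder_dvd_of_L_one_ne_zero`
  (`LeadingTermPPartRankLeOne`, bsd-percentage literature seat): `#E(ℚ)` as `W.torsionOrder`,
  "additive reduction at `p`" as `¬ good(p) ∧ ¬ mult(p)` on the `ℤ_p`-minimal model, hypotheses
  `L(E,1) ≠ 0`, `Finite Ш`;
* `Literature.NumberTheory.EllipticCurves.Wuthrich2014.sha_dvd_analyticSha`
  (`Wuthrich2014/ReducibleDivisibility`, rank-≤1 residual cell): `#E(ℚ)` as `Nat.card E(ℚ)`,
  "additive" as Mathlib's `HasAdditiveReduction` of the `ℤ_p`-minimal model, hypotheses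
  `L(E,1) ≠ 0`, `Finite E(ℚ)`, `Finite Ш`.

This file proves, as the cell referee asked (REFEREE.md F2, "dedup bridge owed"):
* `sha_dvd_analyticSha_of_shaOrder_dvd` — the first spelling implies the second, unconditionally
  (Mathlib's trichotomy good/multiplicative/additive for a minimal equation, and
  `#E(ℚ)_tors = #E(ℚ)` for finite `E(ℚ)`);
* `shaOrder_dvd_of_sha_dvd_analyticSha` — the second implies the first GRANTED that `E(ℚ)` is
  finite when `L(E,1) ≠ 0` (Kolyvagin / Kato; supplied here through Gross–Zagier–Kolyvagin,
  `rank_eq_analyticRank_of_analyticRank_le_one`, the only input by which the two differ).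
So a result citing either spelling cites ONE theorem of the literature (Wuthrich 2014, Prop. 21).
-/

set_option autoImplicit false

noncomputable section

open scoped Classical

open WeierstrassCurve Literature.NumberTheory.EllipticCurves

namespace Literature.NumberTheory.EllipticCurves.Wuthrich2014

/-- **Dedup bridge, first direction (unconditional):** the bsd-percentage spelling
`Wuthrich2014_shaOrder_dvd_of_L_one_ne_zero` of Wuthrich 2014, Prop. 21 implies the residual
cell's spelling `sha_dvd_analyticSha`. Translation of the two differing conjuncts: for finite
`E(ℚ)`, `W.torsionOrder = Nat.card E(ℚ)` (`torsionOrder_eq_natCard_of_finite`); a `ℤ_p`-minimal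
Weierstrass equation with neither good nor multiplicative reduction has additive reduction
(Mathlib `hasGoodReduction_or_hasMultiplicativeReduction_or_hasAdditiveReduction`).
[cite: Wuthrich2014, Prop. 21 (p. 400)] -/
theorem sha_dvd_analyticSha_of_shaOrder_dvd (h : Wuthrich2014_shaOrder_dvd_of_L_one_ne_zero) :
    sha_dvd_analyticSha := by
  intro W _ _ hL hE hsha
  obtain ⟨q, C, hq, hC0, hsupp, m, hdiv⟩ := h W hL hsha
  haveI := hE
  refine ⟨q, C, m, hq, hC0, ?_, ?_⟩
  · intro p _ hvC
    rcases hsupp p hvC with h2 | ⟨hng, hnm⟩ | hex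
    · exact Or.inl h2
    · refine Or.inr (Or.inl ?_)
      rcases WeierstrassCurve.hasGoodReduction_or_hasMultiplicativeReduction_or_hasAdditiveReduction
          (R := ℤ_[p]) (W := (W.baseChange ℚ_[p]).minimal ℤ_[p]) with hg | hm | ha
      · exact absurd hg hng
      · exact absurd hm hnm
      · exact ha
    · exact Or.inr (Or.inr hex)
  · rw [← W.torsionOrder_eq_natCard_of_finite]
    exact hdiv

/-- **Dedup bridge, second direction** (granting Gross–Zagier–Kolyvagin `hGZK` for the finiteness of
`E(ℚ)` when `L(E,1) ≠ 0`): the residual cell's spelling `sha_dvd_analyticSha` of Wuthrich 2014,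
Prop. 21 implies the bsd-percentage spelling `Wuthrich2014_shaOrder_dvd_of_L_one_ne_zero`
(additive ⇒ neither good nor multiplicative: Mathlib `HasAdditiveReduction.not_hasGoodReduction`,
`….not_hasMultiplicativeReduction`). [cite: Wuthrich2014, Prop. 21 (p. 400)] -/
theorem shaOrder_dvd_of_sha_dvd_analyticSha (hGZK : rank_eq_analyticRank_of_analyticRank_le_one)
    (h : sha_dvd_analyticSha) : Wuthrich2014_shaOrder_dvd_of_L_one_ne_zero := by
  intro W _ _ hL hsha
  have hr0 : W.analyticRank = 0 := analyticRank_eq_zero_of_entireLFunction_one_ne_zero W hL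
  obtain ⟨hrank, -⟩ := hGZK W (by rw [hr0]; exact zero_le_one)
  have hmw0 : W.mordellWeilRank = 0 := by rw [hrank, hr0]
  haveI hE : Finite W.toAffine.Point := W.finite_point_of_rank_zero hmw0
  obtain ⟨q, C, m, hq, hC0, hsupp, hdiv⟩ := h W hL hE hsha
  refine ⟨q, C, hq, hC0, ?_, m, ?_⟩
  · intro p _ hvC
    rcases hsupp p hvC with h2 | ha | hex
    · exact Or.inl h2
    · exact Or.inr (Or.inl ⟨ha.not_hasGoodReduction, ha.not_hasMultiplicativeReduction⟩)
    · exact Or.inr (Or.inr hex)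
  · rw [W.torsionOrder_eq_natCard_of_finite]
    exact hdiv

end Literature.NumberTheory.EllipticCurves.Wuthrich2014

end
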